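import Summits.ValiantsHypothesis.ValiantsHypothesis.Theorems.KPlusLogSqLawTropicalExchange

/-!
# Route «KPlusLogSqLaw» — BLOCK IRREVERSIBILITY along dominant chains (a corollary of the exchange lemma)

HONEST FRAMING.  Helper file for the lifting cruxes of route `KPlusLogSqLaw` (object-search cell `pub-symmetroid`): the live
crux `Summit.ValiantsHypothesis.ValiantsHypothesis.Theses.KPlusLogSqLaw.WeakLifting` (ledger item `stmt-ValiantsHypothesis-19561`)
and the cell's D2 fork «is the tropical count `T(m,4)` quadratic or cubic?» (the `K = 4` rung of the aside `Lifting`); seat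
val-sym-lift-p3 (g5), 2026-08-27.  It proves two STRUCTURAL COROLLARIES of the component exchange lemma
`TropicalCensus.sum_lt_sum_of_swap` (file `…TropicalExchange.lean`) and nothing else: no statement about `TropicalB`,
`WeakLifting`, `Lifting`, `KPlusLogSqLaw`, `MatrixDescartes` or `VP ≠ VNP` is asserted or assumed.

THE LAW.  Call a column set `C` ADMISSIBLE for two Leibniz terms `q, r` when they use the same rows on `C` as sets
(`C.image σ_q = C.image σ_r`); the restriction of a term to `C` is its «block configuration» on `C`.
* `not_swap_reversed` — **a block configuration change is never undone.**  If `q` is dominant at `θa` and `r` at `θb > θa`,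
  `q'` dominant at `θc` and `r'` at `θd > θc` (four terms of ONE design, e.g. four members of one dominant chain, in any
  relative position of the two pairs), `C` is admissible for `(q, r)`, and the later pair shows the REVERSED change on `C`
  (`q'|_C = r|_C`, `r'|_C = q|_C`), then `q|_C = r|_C`: the block did not change at all.  (Two applications of
  `sum_lt_sum_of_swap` give `Σ_C d(λ_q) < Σ_C d(λ_r) = Σ_C d(λ_{q'}) < Σ_C d(λ_{r'}) = Σ_C d(λ_q)`.)
* `sum_le_sum_of_swap` / `sum_le_sum_of_swap_chain` / `eq_on_of_sum_eq` — the same fact as a WEAK MONOTONICITY of block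
  weights: along a dominant chain, for positions `u < w` and a column set `C` admissible for the two terms,
  `Σ_{i∈C} d(λ_u i) ≤ Σ_{i∈C} d(λ_w i)`, with equality only if the two terms agree on `C`; so the configuration of every
  admissible block runs through its values in strictly increasing `d`-weight and may RETURN only to the identical
  configuration, never to a lighter one.

READING (located, not claimed; memo HOME/val-sym-lift-p3/g5/OBSTRUCTIONS-K4-liftp3g5.md).  The law is the engine of the
«context obstruction» for odometer-type `K = 4` families: if the fast digit's encoding on some admissible block repeats on two
different pages, the within-page increase and the cross-page reset of that block are a reversed pair — so a cubic lex family
must encode its fast digit differently on every one of its `Θ(m²)` pages.  Nothing here bounds `T(m,4)`.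
-/

set_option linter.dupNamespace false
set_option autoImplicit false

namespace Summit.ValiantsHypothesis.ValiantsHypothesis.Theorems.LacunarySymmetroidMatrixDescartes.TropicalCensus

open Summit.ValiantsHypothesis.ValiantsHypothesis.Theorems.MatrixDescartes.Negative
open scoped BigOperators
open Finset

section Irreversibility

variable {m K : ℕ}

/-- **Weak monotonicity of block weights.**  If `q` is dominant at `θa` and `r` at `θb > θa` and `C` is admissible
(`C.image σ_q = C.image σ_r`), then `Σ_{i ∈ C} d(λ_q i) ≤ Σ_{i ∈ C} d(λ_r i)` (strictly unless they agree on `C`,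
`sum_lt_sum_of_swap`). [folklore] -/
theorem sum_le_sum_of_swap (d : Fin K → ℕ) (v ε : Fin m → Fin m → Fin K → ℤ) {θa θb : ℤ} (hab : θa < θb)
    {q r : Equiv.Perm (Fin m) × (Fin m → Fin K)} (hq : IsDominant d v ε θa q) (hr : IsDominant d v ε θb r)
    (C : Finset (Fin m)) (hC : C.image q.1 = C.image r.1) :
    ∑ i ∈ C, (d (q.2 i) : ℤ) ≤ ∑ i ∈ C, (d (r.2 i) : ℤ) := by
  classical
  by_cases hdiff : ∃ i ∈ C, (q.1 i, q.2 i) ≠ (r.1 i, r.2 i)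
  · exact le_of_lt (sum_lt_sum_of_swap d v ε hab hq hr C hC hdiff)
  · push Not at hdiff
    refine le_of_eq (sum_congr rfl fun i hi => ?_)
    have h := hdiff i hi
    rw [(Prod.mk.injEq _ _ _ _).mp h |>.2]

/-- **Equality of block weights forces equality of block configurations.**  Under the hypotheses of
`sum_le_sum_of_swap`, if the two `d`-weights on `C` are equal then `q` and `r` agree on `C` (row and class in every
column of `C`). [folklore] -/
theorem eq_on_of_sum_eq (d : Fin K → ℕ) (v ε : Fin m → Fin m → Fin K → ℤ) {θa θb : ℤ} (hab : θa < θb)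
    {q r : Equiv.Perm (Fin m) × (Fin m → Fin K)} (hq : IsDominant d v ε θa q) (hr : IsDominant d v ε θb r)
    (C : Finset (Fin m)) (hC : C.image q.1 = C.image r.1)
    (heq : ∑ i ∈ C, (d (q.2 i) : ℤ) = ∑ i ∈ C, (d (r.2 i) : ℤ)) :
    ∀ i ∈ C, (q.1 i, q.2 i) = (r.1 i, r.2 i) := by
  classical
  by_contra h
  push Not at h
  obtain ⟨i, hi, hne⟩ := h
  have hlt := sum_lt_sum_of_swap d v ε hab hq hr C hC ⟨i, hi, hne⟩
  omega

/-- **BLOCK IRREVERSIBILITY.**  Four dominant terms of one design: `q` at `θa`, `r` at `θb > θa`, `q'` at `θc`,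
`r'` at `θd > θc`.  If `C` is admissible for `(q, r)` and the second pair shows the reversed block configurations
(`q'` agrees with `r` on `C`, `r'` agrees with `q` on `C`), then `q` and `r` already agree on `C` — a block configuration
change `X → Y` seen between an earlier and a later dominant term is never seen as `Y → X` between another earlier/later
pair.  (`Σ_C d λ_q < Σ_C d λ_r = Σ_C d λ_{q'} < Σ_C d λ_{r'} = Σ_C d λ_q` would be absurd.) [folklore] -/
theorem not_swap_reversed (d : Fin K → ℕ) (v ε : Fin m → Fin m → Fin K → ℤ) {θa θb θc θd : ℤ}
    (hab : θa < θb) (hcd : θc < θd)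
    {q r q' r' : Equiv.Perm (Fin m) × (Fin m → Fin K)}
    (hq : IsDominant d v ε θa q) (hr : IsDominant d v ε θb r)
    (hq' : IsDominant d v ε θc q') (hr' : IsDominant d v ε θd r')
    (C : Finset (Fin m)) (hC : C.image q.1 = C.image r.1)
    (hq'r : ∀ i ∈ C, (q'.1 i, q'.2 i) = (r.1 i, r.2 i))
    (hr'q : ∀ i ∈ C, (r'.1 i, r'.2 i) = (q.1 i, q.2 i)) :
    ∀ i ∈ C, (q.1 i, q.2 i) = (r.1 i, r.2 i) := by
  classical
  -- the second pair is admissible on `C` as well, with the roles of the row images exchanged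
  have hq'1 : ∀ i ∈ C, q'.1 i = r.1 i := fun i hi => ((Prod.mk.injEq _ _ _ _).mp (hq'r i hi)).1
  have hr'1 : ∀ i ∈ C, r'.1 i = q.1 i := fun i hi => ((Prod.mk.injEq _ _ _ _).mp (hr'q i hi)).1
  have hq'2 : ∀ i ∈ C, q'.2 i = r.2 i := fun i hi => ((Prod.mk.injEq _ _ _ _).mp (hq'r i hi)).2
  have hr'2 : ∀ i ∈ C, r'.2 i = q.2 i := fun i hi => ((Prod.mk.injEq _ _ _ _).mp (hr'q i hi)).2
  have hC' : C.image q'.1 = C.image r'.1 := by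
    rw [image_congr (fun i hi => hq'1 i (mem_coe.mp hi)), image_congr (fun i hi => hr'1 i (mem_coe.mp hi))]
    exact hC.symm
  have h1 := sum_le_sum_of_swap d v ε hab hq hr C hC
  have h2 := sum_le_sum_of_swap d v ε hcd hq' hr' C hC'
  have e1 : ∑ i ∈ C, (d (q'.2 i) : ℤ) = ∑ i ∈ C, (d (r.2 i) : ℤ) :=
    sum_congr rfl fun i hi => by rw [hq'2 i hi]
  have e2 : ∑ i ∈ C, (d (r'.2 i) : ℤ) = ∑ i ∈ C, (d (q.2 i) : ℤ) :=
    sum_congr rfl fun i hi => by rw [hr'2 i hi]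
  exact eq_on_of_sum_eq d v ε hab hq hr C hC (le_antisymm h1 (by rw [e1, e2] at h2; exact h2))

/-- **Chain form.**  Along a chain of terms dominant at strictly increasing slopes: if positions `u < w` and `u' < w'`
show reversed configurations on a column set `C` admissible for `(p u, p w)` (`p u'` agrees with `p w` on `C` and `p w'`
agrees with `p u` on `C`), then `p u` and `p w` agree on `C`.  In words: the configuration of any admissible block moves
through its values in ONE direction only (by `d`-weight), never returning. [folklore] -/
theorem not_swap_reversed_chain (d : Fin K → ℕ) (v ε : Fin m → Fin m → Fin K → ℤ) {n : ℕ}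
    (θ : Fin (n + 1) → ℤ) (p : Fin (n + 1) → Equiv.Perm (Fin m) × (Fin m → Fin K)) (hθ : StrictMono θ)
    (hdom : ∀ k, IsDominant d v ε (θ k) (p k)) {u w u' w' : Fin (n + 1)} (huw : u < w) (huw' : u' < w')
    (C : Finset (Fin m)) (hC : C.image (p u).1 = C.image (p w).1)
    (h1 : ∀ i ∈ C, ((p u').1 i, (p u').2 i) = ((p w).1 i, (p w).2 i))
    (h2 : ∀ i ∈ C, ((p w').1 i, (p w').2 i) = ((p u).1 i, (p u).2 i)) :
    ∀ i ∈ C, ((p u).1 i, (p u).2 i) = ((p w).1 i, (p w).2 i) :=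
  not_swap_reversed d v ε (hθ huw) (hθ huw') (hdom u) (hdom w) (hdom u') (hdom w') C hC h1 h2

/-- **Weak monotonicity, chain form.**  Along a dominant chain, for positions `u < w` and an admissible column set `C`,
the `d`-weight on `C` does not decrease from `u` to `w`. [folklore] -/
theorem sum_le_sum_of_swap_chain (d : Fin K → ℕ) (v ε : Fin m → Fin m → Fin K → ℤ) {n : ℕ}
    (θ : Fin (n + 1) → ℤ) (p : Fin (n + 1) → Equiv.Perm (Fin m) × (Fin m → Fin K)) (hθ : StrictMono θ)
    (hdom : ∀ k, IsDominant d v ε (θ k) (p k)) {u w : Fin (n + 1)} (huw : u < w)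
    (C : Finset (Fin m)) (hC : C.image (p u).1 = C.image (p w).1) :
    ∑ i ∈ C, (d ((p u).2 i) : ℤ) ≤ ∑ i ∈ C, (d ((p w).2 i) : ℤ) :=
  sum_le_sum_of_swap d v ε (hθ huw) (hdom u) (hdom w) C hC

end Irreversibility

end Summit.ValiantsHypothesis.ValiantsHypothesis.Theorems.LacunarySymmetroidMatrixDescartes.TropicalCensus
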